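import Summits.QuantumFields.YangMills.Theorems.BalabanUVNodesN05SubBP2DK2PerKappaSlotExistsOfGuardedSockets
import Summits.QuantumFields.YangMills.Theorems.BalabanUVNodesN05SubBP2DPerKappaSlotOfZd
import Literature.MathematicalPhysics.QuantumFieldTheory.Balaban1983to89.B9SupplySockB9P3ZdSrcPer
import Literature.MathematicalPhysics.QuantumFieldTheory.Balaban1983to89.B8Prop3PrintedZdGF3P2GammaOfSockPer
import Literature.MathematicalPhysics.QuantumFieldTheory.Balaban1983to89.B8TowerBondsLayerLawSubD

/-!
# BalabanUVNodes ∕ N05 ([Balaban1985RegularSpaces] Lemma 1 p. 79 – Thm 8 p. 101, Prop. 3 p. 87, (1.3)–(1.5) p. 77, p. 77 «Ω_j ⊂ T_η»; [Balaban1985BackgroundPropagators]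
# Thm 3.3 p. 399, (3.42)–(3.47) p. 398): (13)′α — THE WITNESS SLOT OF RECORD Slot8κ′ FROM THE GUARDED SOCKETS, ITS TWO b9-FRAME INPUTS FED BY NAME FROM NODE N06's
# PERIODIC BINDER LEVEL (dag-n06-b FILE 5 `B9SupplySockB9P3ZdSrcPer` §5 + dag-n05-w1's guarded Prop-3 server) — (10)′ A `…K2PerKappaSlotExistsOfGuardedSockets` ∘ N06

Track A of `YM-PLAN.md` (cell `pub-ymgap`, HUMAN RULING D-0062), node **N05**; seat `pub-ymgap-dag-n05-d` (g15), 2026-08-28; bears on K1⁹ `stmt-QuantumFields-27364`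
(`--supports … --as helper`, count-neutral).  The junction edition (13)′ of the g14 successor list, keyed on the periodic junction objects NODE N06 has LANDED
(dag-n06-b g24 p660704 `B9SupplySockB9P3ZdSrcPer`, p662241 `B9Thm33SourceWitnessZdPer`).

WHAT.  (10)′ A `exists_residB8_slot8κ'_of_guardedSockets_at` (p662149) displays, at the PRINT-CLASS PERIODIC members `a : Node00.IdxB8SubDPerκ θ P Mκ Rκ`, the guarded
sourced b9 socket of Proposition 3's frame `SB9srcH2Per` (dag-n05-c T6e's text) and Proposition 3 AS PRINTED at the κ-periodic family `hP3`.  HERE both are FED BY NAME: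
* `SB9srcH2Per` := dag-n06-b's ★★★ `B9SupplySockB9P3ZdSrcPer.sockB9P3srcH2Per_opsAllZdPer_towerBondsP` at `J := IdxB8SubDPerκ θ P Mκ Rκ`, `ι := toZdIdx`, `p := fun _ => P` —
  its member laws DISCHARGED from the index: `NeZero P` (`a.pos`), `Ω₀ = ℤᵈ` (`a.Ω_zero`), `Lᵏ ∣ P` (`a.dvd`), the periodic `κ`-sections of print's class `towerBondsP`
  (`…N05SubBP2DPerKappaSlotOfZd.transferHyps_idxB8SubDPer`, p645824 §1) and EDITION P₀'s class law (`levelSepPP0_of_levelSepPP ∘ IdxB8SubD.levelSepPP_towerBondsP`, `s := 1`);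
  DISPLAYED INSTEAD, per member, at the genuine torus record `opsAllZdPer τ θ.L P (fun k j => towerBondsP θ.L Ω (Λs k) j) ops₀` with print's class (1.31): N06's FIVE ANALYTIC
  BINDERS `InvAtHIPer aI` ([4] Thm 3.11), `GlobAtIPer aT B₀ᴺ` ((3.47)@−3), `HolderAtIH2Per aT C_β β len` ((3.45)), `SrcAtIPer aS c_S`, `SrcHolderAtIH2Per aS c_Sβ` ((3.42)₃∕(3.43) for
  the source term), the record's data (`τ` faithful Hermitian tracial with `C_τ`, `ops₀`, block parameter `M ≥ 1`) and `[FiniteDimensional ℝ θ.𝔸]`.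
* `hP3` := dag-n05-w1's ★ `Node00.prop3_famB8OfRecordSubBP₂DPerκ_of_sockB9P3H2Per` — DISPLAYED INSTEAD, per member: the guarded both-points socket of Proposition 3's frame
  `SockB9P3H2Per P θ.L B₀ B₀β cP₃′ β len η k Ω Λs (fun m l => towerBondsP θ.L Ω (Λs m) l)` at print's class (NODE N06's to serve; LOCATED-JUNCTION-SHAPE on the bus: N06's
  unsourced suppliers `B9SupplySockB9P3ZdH2Per.sockB9P3H2Per_at_univ ∕ _opsAllZdPer_of_binders` conclude at the member's own class `i.Λb` — a class-map-generic twin is wanted).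
THE N06 PIN of (10)′'s socket constants is carried as FOUR EQUATIONS (the door passes `rfl`): `B₀ = max 1 (2·B₀ᴺ·max 1 (qQ d L C_τ β_τ 1))` ([4] (3.40)'s constant as N06 serves it),
`B₀β = 2·max 0 C_β·max 1 (qQ …)`, `γ″ = 2c_Sγ₈ ∕ B₀`, `γβ = (max 0 C_β·c_S∕B₀ᴺ + c_Sβ)·γ₈`; Proposition 3's sourced threshold is `cP₃ := min{1∕16, aI, aT, aS, 1∕(2B₀ᴺ·14(d−1)·M + 1)}`
inside.  UNCHANGED and displayed VERBATIM from (10)′ A: the sourced guarded socket family of Theorem 4's frame `SP5base ∕ SP5 ∕ SH59src ∕ SP5u` (servers: lit-balaban IR-N05-P5NS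
instance (ii) — `B8SockSP5uNestedSrcPer.sockP5uSrcPer_of_lettersAtPerNested` p661113 for `SP5u`, r05's E-ii stack for `SP5base ∕ SP5`; N06's `B9SupplySockH59ZdSrcPer` (dag-n06-b
INTENT-7) for `SH59src`), Proposition 5 at the periodic members of record `p5ePer ∕ p5uPer` (currency 2: `B8Prop5ExistsZdLanPer.prop5Exists_zdLanPer_idxB8LanCκPer` p661913 ∕
`B8Prop5UniqueZdLanPer.prop5Unique_zdLanPer_of_lettersAtPerNested` p658676), Proposition 6 in dag-n05-e's served shape (`hP6`, door recipe of (10)′ A), Theorem 8's constants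
OUTER with (8′)∕(9′)'s inequalities.  Edition β (next file of this seat) feeds `SP5u ∕ p5ePer ∕ p5uPer` by name from the landed servers.
WHAT IS PROVED (one theorem; no estimate; no new definition): ★★★ `exists_residB8_slot8κ'_of_bindersPer_at` — at a given period `P`:
`∃ lam c₁ ρ₀ ax, 0 < c₁ ∧ 1 ≤ ρ₀ ∧ B8LeafOfRecordSubBP₂DPerκ θ P Mκ Rκ ⟨lam.cutSubBP₅κPer P Mκ Rκ c₁ ρ₀, ax⟩` (the Slot8κ′ λ-term's ∃-body at `P`; `P := Mκ·θ.L` as in (10)′ B).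
PROOF: `subst` the four pin equations; `SB9srcH2Per` := N06's §5 theorem at the index (laws by name); `hP3` := dag-n05-w1's server at `inp := ⟨B₀, B₀′⟩`, `C₂ := 2097152(d+1)²L²`;
then (10)′ A verbatim.
HONEST FRAMING: composition BY NAME; 0 estimates of Bałaban's proved here; EVERY displayed binder ∕ socket ∕ `p5ePer` ∕ `p5uPer` ∕ `hP6`'s family remains a HYPOTHESIS of print's ∕ [4]'s
shape (N06's five analytic binders are inhabited so far at the torus member `torusIdx` only — dag-n06-b p662241 §5 — not at every print-class periodic member; the both-points socket
at print's class has no N06 supplier yet); Proposition 7's slot junk-inhabited (census, (10)′ A); count-neutral; **N05 NOT discharged** (director-ym №227 (b): only when every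
consumed socket is served by name); FLAG №4 OPEN; K1⁹ NOT claimed; Bałaban AS PRINTED (Thm 8 SURVIVING form, GAPS G-B8-13); one finite 𝕋⁴ programme at fixed ε; nothing
continuum ∕ ℝ⁴ ∕ OS ∕ mass-gap ∕ Clay.  No `sorry`, no new definition.  Unit `pub-ymgap-dag-n05-d` (g15).
[cite: Balaban1985RegularSpaces, Lemma 1 p.79, Thm 2 p.83, Prop. 3 p.87, Thm 4 p.88, Prop. 5 (1.107)–(1.109) p.94, Prop. 6 (1.134)–(1.138) p.99, Prop. 7 p.100, Thm 8 (1.146) p.101, (1.58)–(1.59) p.86, (1.31) p.82, (1.3)–(1.5) p.77, p.77 («Ω_j ⊂ T_η»); Balaban1985BackgroundPropagators, Thm 3.3 p.399, (3.42)–(3.47) p.398, Thm 3.11 p.416, (3.40) p.397; Balaban1984PropagatorsII, (2.3) p.224]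
-/

noncomputable section

namespace Summit.QuantumFields.YangMills.BalabanUVNodes.N05SubBP2DK2PerKappaSlotExistsOfBindersPer

open Literature.MathematicalPhysics.QuantumFieldTheory.Balaban1983to89
open Literature.MathematicalPhysics.QuantumFieldTheory.Balaban1983to89.Node00
open Literature.MathematicalPhysics.QuantumFieldTheory.Balaban1983to89.B8IdxB8LawsB (IdxB8LawsB IdxB8SubB)
open Literature.MathematicalPhysics.QuantumFieldTheory.Balaban1983to89.B8LeafModelZd (ZdIdx)
open Literature.MathematicalPhysics.QuantumFieldTheory.Balaban1983to89.B8LeafModelZdHP2Per (zdGF3HP₂Per)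
open Literature.MathematicalPhysics.QuantumFieldTheory.Balaban1983to89.B8TowerBondsPrinted (towerBondsP)
open Literature.MathematicalPhysics.QuantumFieldTheory.Balaban1983to89.B8Lemma1NonAbelian (mulCfg)
open Literature.MathematicalPhysics.QuantumFieldTheory.Balaban1983to89.B8LanF146 (LanF146)
open Literature.MathematicalPhysics.QuantumFieldTheory.Balaban1983to89.B8Prop5LandauDataZdPer (zdLanPer)
open Literature.MathematicalPhysics.QuantumFieldTheory.Balaban1983to89.B8LeafModelZd3SockH2Per (SockB9P3H2Per)
open Literature.MathematicalPhysics.QuantumFieldTheory.Balaban1983to89.B9SupplySockB9P3ZdSrcPer (SrcAtIPer SrcHolderAtIH2Per sockB9P3srcH2Per_opsAllZdPer_towerBondsP)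
open Literature.MathematicalPhysics.QuantumFieldTheory.Balaban1983to89.B9SupplySockB9P3ZdLetters (OpsZd)
open Literature.MathematicalPhysics.QuantumFieldTheory.Balaban1983to89.B9Eq327GreenZdHermPer (InvAtHIPer)
open Literature.MathematicalPhysics.QuantumFieldTheory.Balaban1983to89.B9SupplySockB9P3ZdPer (GlobAtIPer)
open Literature.MathematicalPhysics.QuantumFieldTheory.Balaban1983to89.B9SupplySockB9P3ZdH2Per (HolderAtIH2Per)
open Literature.MathematicalPhysics.QuantumFieldTheory.Balaban1983to89.B9SupplySockB9P3ZdAllLettersZdPer (opsAllZdPer)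
open Literature.MathematicalPhysics.QuantumFieldTheory.Balaban1983to89.B9Eq316AveragingTransposeZd (betaTau qQ)
open Literature.MathematicalPhysics.QuantumFieldTheory.Balaban1983to89.B9Eq316AveragingTransposeZdLevelZero (LevelSepPP0 levelSepPP0_of_levelSepPP)
open Literature.MathematicalPhysics.QuantumFieldTheory.Balaban1983to89.B8TowerBondsLayerLawSubD (IdxB8SubD.levelSepPP_towerBondsP)
open Summit.QuantumFields.YangMills.BalabanUVNodes.N05SubBP2DK2PerKappaSlotExistsOfGuardedSockets (exists_residB8_slot8κ'_of_guardedSockets_at)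
open Summit.QuantumFields.YangMills.BalabanUVNodes.N05SubBP2DPerKappaSlotOfZd (transferHyps_idxB8SubDPer)
open T4TermwiseTorus (IsPeriodic)
open MatrixLog B7Prop1Explicit B7Prop2Explicit B7Prop1Local B7Eq92Concrete
open B8Ineq130 (tlo thi)
open B8Ineq132 (InAk covDerivFwd)
open B8Eq119TwistedAxial (Restr129 InAx)
open B8Eq140Level (SideTouches)
open B8Eq138LandauZd (covLap InR138 IsLandau146W)
open B8Eq184Proof (gaugeExp cfgExp)
open B8Eq146AExpansion (iEta plaqCovDeriv)
open B8Eq143PlaqExpansion (pdiv)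
open B7Prop4GeneralLevels (linCovIter)
open B8Eq155JBound (Jcur wsup)
open B8ScaledSupNorm (bondNorm msup Bdd)
open B9Eq340HolderZd (hquot AdmPair)

-- `Site` alone could resolve to the torus sites of `Setup.lean`; re-export the `ℤ^d` sites of `B7Prop1Explicit`.
export B7Prop1Explicit (Site)

section BindersPer

variable (θ : Stage3Params)

/-- ★★★ **THE WITNESS SLOT OF RECORD FROM THE GUARDED SOCKETS, ITS TWO b9-FRAME INPUTS FED BY NAME FROM NODE N06's PERIODIC BINDER LEVEL, AT A GIVEN PERIOD `P`** —
(10)′ A with `SB9srcH2Per` := dag-n06-b's `sockB9P3srcH2Per_opsAllZdPer_towerBondsP` (member laws from the index) and `hP3` := dag-n05-w1's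
`prop3_famB8OfRecordSubBP₂DPerκ_of_sockB9P3H2Per`; displayed instead: N06's five analytic binders per member at the genuine torus record with print's class and the guarded
both-points socket per member at print's class; the N06 pin of the socket constants as four equations; everything else of (10)′ A verbatim.
[cite: Balaban1985RegularSpaces, Lemma 1 – Thm 8 pp.79–101, Prop. 3 p.87, Prop. 5 p.94, (1.58)–(1.59) p.86, (1.31) p.82, (1.3)–(1.5) p.77, p.77 («Ω_j ⊂ T_η»); Balaban1985BackgroundPropagators, Thm 3.3 p.399, (3.42)–(3.47) p.398, Thm 3.11 p.416] -/
theorem exists_residB8_slot8κ'_of_bindersPer_at (hD : 2 ≤ θ.D) [FiniteDimensional ℝ θ.𝔸] (Mκ Rκ P : ℕ)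
    -- NODE N06's GENUINE TORUS RECORD DATA: a faithful Hermitian tracial state `τ` with its Cauchy–Schwarz constant `C_τ`, the base letters `ops₀`, the block parameter `M ≥ 1`
    (τ : θ.𝔸 →ₗ[ℂ] ℂ) (hτp : ∀ a : θ.𝔸, a ≠ 0 → 0 < (τ (star a * a)).re) (hτt : ∀ a b : θ.𝔸, τ (a * b) = τ (b * a))
    (hτs : ∀ a : θ.𝔸, τ (star a) = starRingEnd ℂ (τ a)) {Cτ : ℝ} (hCτ : ∀ x y : θ.𝔸, |(τ (star x * y)).re| ≤ Cτ * ‖x‖ * ‖y‖)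
    (ops₀ : ℝ → ZdIdx θ.D θ.L → ℕ → OpsZd θ.D θ.𝔸) {M : ℝ} (hM1 : 1 ≤ M)
    -- NODE N06's BINDER CONSTANTS ([4] Thm 3.11's `a_I`, (3.47)'s `a_T, B₀ᴺ`, (3.45)'s `C_β`, the source binders' `a_S, c_S, c_Sβ`) — OUTER
    {aI aT aS B₀N Cβ cS cSβ : ℝ} (haI : 0 < aI) (haT : 0 < aT) (haS : 0 < aS) (hB₀N : 0 < B₀N) (hCβ : 0 < Cβ) (hcS : 0 ≤ cS) (hcSβ : 0 ≤ cSβ)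
    -- the primitive constants of the layer ([4] (3.40) `B₀` AS N06 SERVES IT, the free constant `B₀′`, the Hölder pair) — OUTER; `B₀`, `B₀β` PINNED to N06's expressions
    {B₀ B₀' B₀β β : ℝ} {len : Site θ.D → ℝ} (hB₀' : 0 < B₀')
    (hB₀eq : B₀ = max 1 (2 * B₀N * max 1 (qQ θ.D θ.L Cτ (betaTau τ) 1)))
    (hB₀βeq : B₀β = 2 * max 0 Cβ * max 1 (qQ θ.D θ.L Cτ (betaTau τ) 1))
    -- PROPOSITION 6 IN dag-n05-e's SERVED SHAPE (`prop6Printed_zdCubP_γ_holds_record_dvd`): print cubes at `ρ₀`, constants `B₁⋆, c₁⋆` — OUTER, displayed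
    {ρ₀ : ℕ} {B₁s c₁s : ℝ} (hρ₀ : 1 ≤ ρ₀) (hc₁s : 0 < c₁s)
    (hP6 : ∀ {ι : Type} (f : ι → ZdIdx θ.D θ.L) (B₁'' c₁'' : ℝ), B₁s ≤ B₁'' → c₁'' ≤ c₁s →
      B8.Prop6Printed θ.D (θ.L : ℝ) B₁'' c₁'' (fun j => zdCubP θ.𝔸 θ.L ρ₀ (f j)))
    -- Theorem 8's constants — OUTER, with (8′)∕(9′)'s inequalities and `B₁⋆ ≤ 5dLB₈(1+11d²)`; `γ″`, `γβ` PINNED to N06's expressions; the both-points threshold `cP₃′` free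
    {cP cu cP3' γ₈ γ' γ'' γβ B₈ B₈β : ℝ} (hcP : 0 < cP) (hcu : 0 < cu) (hcP3' : 0 < cP3') (hγ₈ : 1 ≤ γ₈) (hγ' : 0 ≤ γ')
    (hγ''eq : γ'' = 2 * cS * γ₈ / max 1 (2 * B₀N * max 1 (qQ θ.D θ.L Cτ (betaTau τ) 1)))
    (hγβeq : γβ = (max 0 Cβ * cS / B₀N + cSβ) * γ₈)
    (hB : 2 ≤ 5 * (θ.D : ℝ) * θ.L * B₀) (hB₀8 : B₀ ≤ B₈)
    (hγB : 5 * (θ.D : ℝ) * θ.L * B₀ + 2 * (γ' * B₀) ≤ 5 * (θ.D : ℝ) * θ.L * B₈)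
    (hγB'' : 5 * (θ.D : ℝ) * θ.L * B₀ + 2 * (γ'' * B₀) ≤ 5 * (θ.D : ℝ) * θ.L * B₈)
    (hB8β : 5 * (θ.D : ℝ) * θ.L * B₀β + 2 * B₀β * (γ'' * B₀) + γβ ≤ 5 * (θ.D : ℝ) * θ.L * B₈β)
    (hB₁big : B₁s ≤ 5 * (θ.D : ℝ) * θ.L * B₈ * (1 + 11 * (θ.D : ℝ) ^ 2))
    -- THE ONE SOURCED GUARDED SOCKET FAMILY OF THEOREM 4's FRAME AT (1.146) (dag-n05-c's (9′) texts VERBATIM, as in (10)′ A),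
    -- at the PRINT-CLASS PERIODIC MEMBERS `a : IdxB8SubDPerκ θ P Mκ Rκ` (member `a.toZdIdx`, period `P`) — HYPOTHESES (print's shape; servers: IR-N05-P5NS (ii), N06 FILE 7)
    (SP5base : ∀ a : IdxB8SubDPerκ θ P Mκ Rκ, ∀ α₀ α₁ : ℝ, 0 < α₀ → 0 < α₁ → α₀ + α₁ ≤ cP →
      ∀ U₀ U' : Site θ.D → Fin θ.D → θ.𝔸ˣ, (∀ x κ, U₀ x κ ∈ unitaryUnits θ.𝔸) → (∀ x κ, U' x κ ∈ unitaryUnits θ.𝔸) →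
      IsPeriodic P U₀ → IsPeriodic P U' → ∀ φ : Site θ.D → θ.𝔸, (((InR138 θ.L a.toZdIdx.k a.toZdIdx.η (a.toZdIdx.Ω 0) (a.toZdIdx.Λs a.toZdIdx.k) U₀ φ ∧ (∀ x, IsSelfAdjoint (φ x)) ∧ (∀ x, x ∉ a.toZdIdx.Ω 0 → φ x = 0) ∧
          Bdd θ.L a.toZdIdx.k a.toZdIdx.η (-(2 : ℝ)) (fun j (x : Site θ.D) => x ∈ a.toZdIdx.Ω j) φ) ∧ IsPeriodic P φ) ∧
        msup θ.L a.toZdIdx.k a.toZdIdx.η (-(2 : ℝ)) (fun j (x : Site θ.D) => x ∈ a.toZdIdx.Ω j) φ < γ₈ * (α₀ + α₁)) →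
      InAk θ.L a.toZdIdx.k a.toZdIdx.η α₀ a.toZdIdx.Ω U₀ → InAk θ.L a.toZdIdx.k a.toZdIdx.η α₀ a.toZdIdx.Ω (mulCfg U' U₀) → (∀ m, m ≤ a.toZdIdx.k → InAx θ.L m (a.toZdIdx.Λs m) U₀ (mulCfg U' U₀)) →
      (∀ j, j ≤ a.toZdIdx.k → ∀ (z : Site θ.D) (μ : Fin θ.D),
        ((∀ x, InBox (tlo θ.L z j) (thi θ.L z j) x → x ∈ a.toZdIdx.Ω j) ∨ (∀ x, InBox (tlo θ.L (z + e μ) j) (thi θ.L (z + e μ) j) x → x ∈ a.toZdIdx.Ω j)) →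
        ‖(avgIter θ.L (mulCfg U' U₀) j z μ : θ.𝔸) - (avgIter θ.L U₀ j z μ : θ.𝔸)‖ ≤ α₁) →
      (∀ b ∈ {b : Site θ.D × Fin θ.D | SideTouches (a.toZdIdx.Ω 0) b.1 b.2}, ‖((U' b.1 b.2 : θ.𝔸ˣ) : θ.𝔸) - 1‖ ≤ α₁) →
      (∃ (v : Site θ.D → θ.𝔸ˣ) (la : Site θ.D → θ.𝔸), (∀ x, v x ∈ unitaryUnits θ.𝔸) ∧ (∀ x, x ∉ a.toZdIdx.Ω 0 → v x = 1) ∧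
        (∀ j, j ≤ 1 → ∀ b ∈ {b : Site θ.D × Fin θ.D | SideTouches (a.toZdIdx.Ω j) b.1 b.2}, (v b.1 : θ.𝔸) = ((gaugeExp la b.1 : θ.𝔸ˣ) : θ.𝔸) ∧
        (v (b.1 + e b.2) : θ.𝔸) = ((gaugeExp la (b.1 + e b.2) : θ.𝔸ˣ) : θ.𝔸)) ∧
        (∀ j, j ≤ 1 → ∀ b ∈ {b : Site θ.D × Fin θ.D | SideTouches (a.toZdIdx.Ω j) b.1 b.2},
        ‖la b.1‖ ≤ (8 * B₀' * (5 * (θ.D : ℝ) * θ.L * B₈) * (α₀ + α₁)) ∧ ((θ.L : ℝ) ^ j * a.toZdIdx.η) * ‖covDerivFwd a.toZdIdx.η U₀ b.2 la b.1‖ ≤ (8 * B₀' * (5 * (θ.D : ℝ) * θ.L * B₈) * (α₀ + α₁))) ∧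
        LanF146 θ.L a.toZdIdx.k a.toZdIdx.η (a.toZdIdx.Ω 0) a.toZdIdx.Λs U₀ φ 1 (mgauge U₀ v⁻¹ U') ∧ Restr129 θ.L 1 (a.toZdIdx.Λs 1) U₀ ((1 : Site θ.D → θ.𝔸ˣ) * v) ∧ IsPeriodic P v))
    (SP5 : ∀ a : IdxB8SubDPerκ θ P Mκ Rκ, ∀ α₀ α₁ : ℝ, 0 < α₀ → 0 < α₁ → α₀ + α₁ ≤ cP →
      ∀ U₀ U' : Site θ.D → Fin θ.D → θ.𝔸ˣ, (∀ x κ, U₀ x κ ∈ unitaryUnits θ.𝔸) → (∀ x κ, U' x κ ∈ unitaryUnits θ.𝔸) →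
      IsPeriodic P U₀ → IsPeriodic P U' → ∀ φ : Site θ.D → θ.𝔸, (((InR138 θ.L a.toZdIdx.k a.toZdIdx.η (a.toZdIdx.Ω 0) (a.toZdIdx.Λs a.toZdIdx.k) U₀ φ ∧ (∀ x, IsSelfAdjoint (φ x)) ∧ (∀ x, x ∉ a.toZdIdx.Ω 0 → φ x = 0) ∧
          Bdd θ.L a.toZdIdx.k a.toZdIdx.η (-(2 : ℝ)) (fun j (x : Site θ.D) => x ∈ a.toZdIdx.Ω j) φ) ∧ IsPeriodic P φ) ∧
        msup θ.L a.toZdIdx.k a.toZdIdx.η (-(2 : ℝ)) (fun j (x : Site θ.D) => x ∈ a.toZdIdx.Ω j) φ < γ₈ * (α₀ + α₁)) →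
      InAk θ.L a.toZdIdx.k a.toZdIdx.η α₀ a.toZdIdx.Ω U₀ → InAk θ.L a.toZdIdx.k a.toZdIdx.η α₀ a.toZdIdx.Ω (mulCfg U' U₀) → (∀ m, m ≤ a.toZdIdx.k → InAx θ.L m (a.toZdIdx.Λs m) U₀ (mulCfg U' U₀)) →
      (∀ j, j ≤ a.toZdIdx.k → ∀ (z : Site θ.D) (μ : Fin θ.D),
        ((∀ x, InBox (tlo θ.L z j) (thi θ.L z j) x → x ∈ a.toZdIdx.Ω j) ∨ (∀ x, InBox (tlo θ.L (z + e μ) j) (thi θ.L (z + e μ) j) x → x ∈ a.toZdIdx.Ω j)) →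
        ‖(avgIter θ.L (mulCfg U' U₀) j z μ : θ.𝔸) - (avgIter θ.L U₀ j z μ : θ.𝔸)‖ ≤ α₁) →
      (∀ b ∈ {b : Site θ.D × Fin θ.D | SideTouches (a.toZdIdx.Ω 0) b.1 b.2}, ‖((U' b.1 b.2 : θ.𝔸ˣ) : θ.𝔸) - 1‖ ≤ α₁) →
      (∀ m, 1 ≤ m → m < a.toZdIdx.k → ∀ (u₁ : Site θ.D → θ.𝔸ˣ) (U₁ : Site θ.D → Fin θ.D → θ.𝔸ˣ) (A : Site θ.D → Fin θ.D → θ.𝔸),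
        (∀ x, u₁ x ∈ unitaryUnits θ.𝔸) → (∀ x, x ∉ a.toZdIdx.Ω 0 → u₁ x = 1) → IsPeriodic P u₁ → IsPeriodic P U₁ → IsPeriodic P A →
        mgauge U₀ u₁ U₁ = U' → Restr129 θ.L m (a.toZdIdx.Λs m) U₀ u₁ →
        LanF146 θ.L a.toZdIdx.k a.toZdIdx.η (a.toZdIdx.Ω 0) a.toZdIdx.Λs U₀ φ m U₁ →
        (∀ j, j ≤ m → ∀ b ∈ {b : Site θ.D × Fin θ.D | SideTouches (a.toZdIdx.Ω j) b.1 b.2},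
        U₁ b.1 b.2 = cfgExp a.toZdIdx.η A b.1 b.2 ∧ IsSelfAdjoint (A b.1 b.2) ∧ ‖A b.1 b.2‖ ≤ (5 * (θ.D : ℝ) * θ.L * B₈ * (α₀ + α₁)) * ((θ.L : ℝ) ^ j * a.toZdIdx.η)⁻¹) →
        ∃ (v : Site θ.D → θ.𝔸ˣ) (la : Site θ.D → θ.𝔸), (∀ x, v x ∈ unitaryUnits θ.𝔸) ∧ (∀ x, x ∉ a.toZdIdx.Ω 0 → v x = 1) ∧
        (∀ j, j ≤ m + 1 → ∀ b ∈ {b : Site θ.D × Fin θ.D | SideTouches (a.toZdIdx.Ω j) b.1 b.2}, (v b.1 : θ.𝔸) = ((gaugeExp la b.1 : θ.𝔸ˣ) : θ.𝔸) ∧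
        (v (b.1 + e b.2) : θ.𝔸) = ((gaugeExp la (b.1 + e b.2) : θ.𝔸ˣ) : θ.𝔸)) ∧
        (∀ j, j ≤ m + 1 → ∀ b ∈ {b : Site θ.D × Fin θ.D | SideTouches (a.toZdIdx.Ω j) b.1 b.2},
        ‖la b.1‖ ≤ (8 * B₀' * (5 * (θ.D : ℝ) * θ.L * B₈) * (α₀ + α₁)) ∧ ((θ.L : ℝ) ^ j * a.toZdIdx.η) * ‖covDerivFwd a.toZdIdx.η U₀ b.2 la b.1‖ ≤ (8 * B₀' * (5 * (θ.D : ℝ) * θ.L * B₈) * (α₀ + α₁))) ∧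
        LanF146 θ.L a.toZdIdx.k a.toZdIdx.η (a.toZdIdx.Ω 0) a.toZdIdx.Λs U₀ φ (m + 1) (mgauge U₀ v⁻¹ U₁) ∧ Restr129 θ.L (m + 1) (a.toZdIdx.Λs (m + 1)) U₀ (u₁ * v) ∧ IsPeriodic P v))
    (SH59src : ∀ a : IdxB8SubDPerκ θ P Mκ Rκ, ∀ α₀ α₁ : ℝ, 0 < α₀ → 0 < α₁ → α₀ + α₁ ≤ cP →
      ∀ U₀ U' : Site θ.D → Fin θ.D → θ.𝔸ˣ, (∀ x κ, U₀ x κ ∈ unitaryUnits θ.𝔸) → (∀ x κ, U' x κ ∈ unitaryUnits θ.𝔸) →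
      IsPeriodic P U₀ → IsPeriodic P U' → ∀ φ : Site θ.D → θ.𝔸, (((InR138 θ.L a.toZdIdx.k a.toZdIdx.η (a.toZdIdx.Ω 0) (a.toZdIdx.Λs a.toZdIdx.k) U₀ φ ∧ (∀ x, IsSelfAdjoint (φ x)) ∧ (∀ x, x ∉ a.toZdIdx.Ω 0 → φ x = 0) ∧
          Bdd θ.L a.toZdIdx.k a.toZdIdx.η (-(2 : ℝ)) (fun j (x : Site θ.D) => x ∈ a.toZdIdx.Ω j) φ) ∧ IsPeriodic P φ) ∧
        msup θ.L a.toZdIdx.k a.toZdIdx.η (-(2 : ℝ)) (fun j (x : Site θ.D) => x ∈ a.toZdIdx.Ω j) φ < γ₈ * (α₀ + α₁)) →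
      InAk θ.L a.toZdIdx.k a.toZdIdx.η α₀ a.toZdIdx.Ω U₀ → InAk θ.L a.toZdIdx.k a.toZdIdx.η α₀ a.toZdIdx.Ω (mulCfg U' U₀) → (∀ m, m ≤ a.toZdIdx.k → InAx θ.L m (a.toZdIdx.Λs m) U₀ (mulCfg U' U₀)) →
      (∀ j, j ≤ a.toZdIdx.k → ∀ (z : Site θ.D) (μ : Fin θ.D),
        ((∀ x, InBox (tlo θ.L z j) (thi θ.L z j) x → x ∈ a.toZdIdx.Ω j) ∨ (∀ x, InBox (tlo θ.L (z + e μ) j) (thi θ.L (z + e μ) j) x → x ∈ a.toZdIdx.Ω j)) →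
        ‖(avgIter θ.L (mulCfg U' U₀) j z μ : θ.𝔸) - (avgIter θ.L U₀ j z μ : θ.𝔸)‖ ≤ α₁) →
      (∀ b ∈ {b : Site θ.D × Fin θ.D | SideTouches (a.toZdIdx.Ω 0) b.1 b.2}, ‖((U' b.1 b.2 : θ.𝔸ˣ) : θ.𝔸) - 1‖ ≤ α₁) →
      (∀ m, 1 ≤ m → m ≤ a.toZdIdx.k → ∀ (u : Site θ.D → θ.𝔸ˣ) (W : Site θ.D → Fin θ.D → θ.𝔸ˣ) (A' : Site θ.D → Fin θ.D → θ.𝔸),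
        (∀ x, u x ∈ unitaryUnits θ.𝔸) → IsPeriodic P u → IsPeriodic P W → IsPeriodic P A' →
        mgauge U₀ u W = U' → Restr129 θ.L m (a.toZdIdx.Λs m) U₀ u → LanF146 θ.L a.toZdIdx.k a.toZdIdx.η (a.toZdIdx.Ω 0) a.toZdIdx.Λs U₀ φ m W →
        (∀ y τ, IsSelfAdjoint (A' y τ)) →
        (∀ j, j ≤ m → ∀ y τ, SideTouches (a.toZdIdx.Ω j) y τ →
        W y τ = cfgExp a.toZdIdx.η A' y τ ∧ ‖A' y τ‖ ≤ (2 * (θ.L * (5 * (θ.D : ℝ) * θ.L * B₈ * (α₀ + α₁))) + 8 * (8 * B₀' * (5 * (θ.D : ℝ) * θ.L * B₈) * (α₀ + α₁))) * ((θ.L : ℝ) ^ j * a.toZdIdx.η)⁻¹) →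
        (∀ y τ, (∀ j, j ≤ m → ¬ SideTouches (a.toZdIdx.Ω j) y τ) → A' y τ = 0) →
        msup θ.L m a.toZdIdx.η (-(1 : ℝ)) (fun j (b : Site θ.D × Fin θ.D) => SideTouches (a.toZdIdx.Ω j) b.1 b.2) (fun b => A' b.1 b.2)
        ≤ B₀ * (bondNorm θ.L m a.toZdIdx.η (-(3 : ℝ)) a.toZdIdx.Ω (fun x μ => Jcur a.toZdIdx.η U₀ A' μ x)
        + wsup 1 (fun p : {p : ℕ × (Site θ.D × Fin θ.D) // p.1 ≤ m ∧ p.2 ∈ towerBondsP θ.L a.toZdIdx.Ω (a.toZdIdx.Λs m) p.1} =>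
        linCovIter θ.L U₀ (iEta a.toZdIdx.η A') p.1.1 p.1.2.1 p.1.2.2)) + γ' * B₀ * (α₀ + α₁) ∧
        msup θ.L m a.toZdIdx.η (-(2 : ℝ)) (fun j (t : Fin θ.D × Fin θ.D × Site θ.D) => SideTouches (a.toZdIdx.Ω j) t.2.2 t.2.1)
        (fun t => covDerivFwd a.toZdIdx.η U₀ t.1 (fun z => A' z t.2.1) t.2.2)
        ≤ B₀ * (bondNorm θ.L m a.toZdIdx.η (-(3 : ℝ)) a.toZdIdx.Ω (fun x μ => Jcur a.toZdIdx.η U₀ A' μ x)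
        + wsup 1 (fun p : {p : ℕ × (Site θ.D × Fin θ.D) // p.1 ≤ m ∧ p.2 ∈ towerBondsP θ.L a.toZdIdx.Ω (a.toZdIdx.Λs m) p.1} =>
        linCovIter θ.L U₀ (iEta a.toZdIdx.η A') p.1.1 p.1.2.1 p.1.2.2)) + γ' * B₀ * (α₀ + α₁)))
    (SP5u : ∀ a : IdxB8SubDPerκ θ P Mκ Rκ, ∀ α₀ α₁ : ℝ, 0 < α₀ → 0 < α₁ → α₀ + α₁ ≤ cP →
      ∀ U₀ U' : Site θ.D → Fin θ.D → θ.𝔸ˣ, (∀ x κ, U₀ x κ ∈ unitaryUnits θ.𝔸) → (∀ x κ, U' x κ ∈ unitaryUnits θ.𝔸) →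
      IsPeriodic P U₀ → IsPeriodic P U' → ∀ φ : Site θ.D → θ.𝔸, (((InR138 θ.L a.toZdIdx.k a.toZdIdx.η (a.toZdIdx.Ω 0) (a.toZdIdx.Λs a.toZdIdx.k) U₀ φ ∧ (∀ x, IsSelfAdjoint (φ x)) ∧ (∀ x, x ∉ a.toZdIdx.Ω 0 → φ x = 0) ∧
          Bdd θ.L a.toZdIdx.k a.toZdIdx.η (-(2 : ℝ)) (fun j (x : Site θ.D) => x ∈ a.toZdIdx.Ω j) φ) ∧ IsPeriodic P φ) ∧
        msup θ.L a.toZdIdx.k a.toZdIdx.η (-(2 : ℝ)) (fun j (x : Site θ.D) => x ∈ a.toZdIdx.Ω j) φ < γ₈ * (α₀ + α₁)) →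
      InAk θ.L a.toZdIdx.k a.toZdIdx.η α₀ a.toZdIdx.Ω U₀ → InAk θ.L a.toZdIdx.k a.toZdIdx.η α₀ a.toZdIdx.Ω (mulCfg U' U₀) → (∀ m, m ≤ a.toZdIdx.k → InAx θ.L m (a.toZdIdx.Λs m) U₀ (mulCfg U' U₀)) →
      (∀ j, j ≤ a.toZdIdx.k → ∀ (z : Site θ.D) (μ : Fin θ.D),
        ((∀ x, InBox (tlo θ.L z j) (thi θ.L z j) x → x ∈ a.toZdIdx.Ω j) ∨ (∀ x, InBox (tlo θ.L (z + e μ) j) (thi θ.L (z + e μ) j) x → x ∈ a.toZdIdx.Ω j)) →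
        ‖(avgIter θ.L (mulCfg U' U₀) j z μ : θ.𝔸) - (avgIter θ.L U₀ j z μ : θ.𝔸)‖ ≤ α₁) →
      (∀ b ∈ {b : Site θ.D × Fin θ.D | SideTouches (a.toZdIdx.Ω 0) b.1 b.2}, ‖((U' b.1 b.2 : θ.𝔸ˣ) : θ.𝔸) - 1‖ ≤ α₁) →
      ∀ u₁ : Site θ.D → θ.𝔸ˣ, (∀ x, u₁ x ∈ unitaryUnits θ.𝔸) → (∀ x, x ∉ a.toZdIdx.Ω 0 → u₁ x = 1) → IsPeriodic P u₁ → Restr129 θ.L a.toZdIdx.k (a.toZdIdx.Λs a.toZdIdx.k) U₀ u₁ →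
      LanF146 θ.L a.toZdIdx.k a.toZdIdx.η (a.toZdIdx.Ω 0) a.toZdIdx.Λs U₀ φ a.toZdIdx.k (mgauge U₀ u₁⁻¹ U') →
      (∃ A₁ : Site θ.D → Fin θ.D → θ.𝔸, ∀ j, j ≤ a.toZdIdx.k → ∀ (x : Site θ.D) (κ : Fin θ.D), SideTouches (a.toZdIdx.Ω j) x κ →
        mgauge U₀ u₁⁻¹ U' x κ = cfgExp a.toZdIdx.η A₁ x κ ∧ ‖A₁ x κ‖ ≤ (5 * (θ.D : ℝ) * θ.L * B₈ * (α₀ + α₁)) * ((θ.L : ℝ) ^ j * a.toZdIdx.η)⁻¹) →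
      ∀ (v w : Site θ.D → θ.𝔸ˣ) (la mu : Site θ.D → θ.𝔸),
      IsPeriodic P v → IsPeriodic P w → IsPeriodic P la → IsPeriodic P mu →
      (∀ x, ((gaugeExp la x : θ.𝔸ˣ) : θ.𝔸) = ((v x : θ.𝔸ˣ) : θ.𝔸) ∧ IsSelfAdjoint (la x) ∧ ‖la x‖ < cu) → (∀ x, x ∉ a.toZdIdx.Ω 0 → la x = 0) →
      (∀ j, j ≤ a.toZdIdx.k → ∀ b ∈ {b : Site θ.D × Fin θ.D | SideTouches (a.toZdIdx.Ω j) b.1 b.2}, ((θ.L : ℝ) ^ j * a.toZdIdx.η) * ‖covDerivFwd a.toZdIdx.η U₀ b.2 la b.1‖ < cu) →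
      (∀ x, ((gaugeExp mu x : θ.𝔸ˣ) : θ.𝔸) = ((w x : θ.𝔸ˣ) : θ.𝔸) ∧ IsSelfAdjoint (mu x) ∧ ‖mu x‖ < cu) → (∀ x, x ∉ a.toZdIdx.Ω 0 → mu x = 0) →
      (∀ j, j ≤ a.toZdIdx.k → ∀ b ∈ {b : Site θ.D × Fin θ.D | SideTouches (a.toZdIdx.Ω j) b.1 b.2}, ((θ.L : ℝ) ^ j * a.toZdIdx.η) * ‖covDerivFwd a.toZdIdx.η U₀ b.2 mu b.1‖ < cu) →
      LanF146 θ.L a.toZdIdx.k a.toZdIdx.η (a.toZdIdx.Ω 0) a.toZdIdx.Λs U₀ φ a.toZdIdx.k (mgauge U₀ v⁻¹ (mgauge U₀ u₁⁻¹ U')) → Restr129 θ.L a.toZdIdx.k (a.toZdIdx.Λs a.toZdIdx.k) U₀ (u₁ * v) →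
      LanF146 θ.L a.toZdIdx.k a.toZdIdx.η (a.toZdIdx.Ω 0) a.toZdIdx.Λs U₀ φ a.toZdIdx.k (mgauge U₀ w⁻¹ (mgauge U₀ u₁⁻¹ U')) → Restr129 θ.L a.toZdIdx.k (a.toZdIdx.Λs a.toZdIdx.k) U₀ (u₁ * w) →
      ∀ x, v x = w x)
    -- NODE N06's FIVE ANALYTIC BINDERS PER MEMBER at the genuine torus record with print's class (1.31) — HYPOTHESES ([4] Thm 3.11, (3.47)@−3, (3.45), (3.42)₃∕(3.43);
    -- dag-n06-b `B9SupplySockB9P3ZdSrcPer` §5's displayed inputs VERBATIM at `ι := toZdIdx`, `p := fun _ => P`; N06's object layer inhabits them)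
    (hinv : ∀ a : IdxB8SubDPerκ θ P Mκ Rκ,
      InvAtHIPer P θ.L (opsAllZdPer τ θ.L P (fun k j => towerBondsP θ.L a.toZdIdx.Ω (a.toZdIdx.Λs k) j) ops₀) aI M a.toZdIdx a.toZdIdx.k)
    (hglob : ∀ a : IdxB8SubDPerκ θ P Mκ Rκ,
      GlobAtIPer P θ.L (opsAllZdPer τ θ.L P (fun k j => towerBondsP θ.L a.toZdIdx.Ω (a.toZdIdx.Λs k) j) ops₀) aT B₀N M a.toZdIdx a.toZdIdx.k)
    (hhol : ∀ a : IdxB8SubDPerκ θ P Mκ Rκ,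
      HolderAtIH2Per P θ.L (opsAllZdPer τ θ.L P (fun k j => towerBondsP θ.L a.toZdIdx.Ω (a.toZdIdx.Λs k) j) ops₀) aT Cβ β len M a.toZdIdx a.toZdIdx.k)
    (hsrc : ∀ a : IdxB8SubDPerκ θ P Mκ Rκ,
      SrcAtIPer P θ.L (opsAllZdPer τ θ.L P (fun k j => towerBondsP θ.L a.toZdIdx.Ω (a.toZdIdx.Λs k) j) ops₀) aS cS M a.toZdIdx a.toZdIdx.k)
    (hsrcH : ∀ a : IdxB8SubDPerκ θ P Mκ Rκ,
      SrcHolderAtIH2Per P θ.L (opsAllZdPer τ θ.L P (fun k j => towerBondsP θ.L a.toZdIdx.Ω (a.toZdIdx.Λs k) j) ops₀) aS cSβ β len M a.toZdIdx a.toZdIdx.k)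
    -- THE GUARDED BOTH-POINTS SOCKET OF PROPOSITION 3's FRAME per member at print's class, threshold `cP₃′` — HYPOTHESIS ([4] Thm 3.3 at periodic `U₀, W, A′`; dag-n05-w1's
    -- `SockB9P3H2Per`; NODE N06's to serve at print's class — LOCATED-JUNCTION-SHAPE)
    (SB9H2Per : ∀ a : IdxB8SubDPerκ θ P Mκ Rκ, SockB9P3H2Per (𝔸 := θ.𝔸) P θ.L B₀ B₀β cP3' β len a.toZdIdx.η a.toZdIdx.k a.toZdIdx.Ω a.toZdIdx.Λs
      (fun m l => towerBondsP θ.L a.toZdIdx.Ω (a.toZdIdx.Λs m) l))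
    -- PROPOSITION 5 (1.108) ∕ (1.109) AT THE PERIODIC MEMBERS OF RECORD (`zdLanPer`; IR-N05-P5NS currency 2) — HYPOTHESES
    (p5ePer : B8.Prop5Exists B₀' (5 * (θ.D : ℝ) * θ.L * B₈ * (1 + 11 * (θ.D : ℝ) ^ 2))
      (lanOfRecordSubCκPer θ P Mκ Rκ (5 * (θ.D : ℝ) * θ.L * B₈ * (1 + 11 * (θ.D : ℝ) ^ 2))))
    (p5uPer : B8.Prop5Unique (lanOfRecordSubCκPer θ P Mκ Rκ (5 * (θ.D : ℝ) * θ.L * B₈ * (1 + 11 * (θ.D : ℝ) ^ 2)))) :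
    ∃ (lam : ResidB8 θ) (c₁ : ℝ) (ρ₀' : ℕ)
      (ax : ∀ j : IdxB8SubDPer θ P, (famB8OfRecordPer θ (lam.cutSubBP₅κPer P Mκ Rκ c₁ ρ₀').β (lam.cutSubBP₅κPer P Mκ Rκ c₁ ρ₀').len P j).Cfg →
        (famB8OfRecordPer θ (lam.cutSubBP₅κPer P Mκ Rκ c₁ ρ₀').β (lam.cutSubBP₅κPer P Mκ Rκ c₁ ρ₀').len P j).Pert →
        (famB8OfRecordPer θ (lam.cutSubBP₅κPer P Mκ Rκ c₁ ρ₀').β (lam.cutSubBP₅κPer P Mκ Rκ c₁ ρ₀').len P j).Pert),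
      0 < c₁ ∧ 1 ≤ ρ₀' ∧ B8LeafOfRecordSubBP₂DPerκ θ P Mκ Rκ ⟨lam.cutSubBP₅κPer P Mκ Rκ c₁ ρ₀', ax⟩ := by
  -- THE N06 PIN: the four socket constants are N06's expressions
  subst hB₀eq hB₀βeq hγ''eq hγβeq
  have hγ₈pos : 0 < γ₈ := lt_of_lt_of_le one_pos hγ₈
  have hB₀ : 0 < max 1 (2 * B₀N * max 1 (qQ θ.D θ.L Cτ (betaTau τ) 1)) := lt_of_lt_of_le one_pos (le_max_left _ _)
  have hB₀β : 0 < 2 * max 0 Cβ * max 1 (qQ θ.D θ.L Cτ (betaTau τ) 1) :=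
    mul_pos (mul_pos two_pos (lt_of_lt_of_le hCβ (le_max_right _ _))) (lt_of_lt_of_le one_pos (le_max_left _ _))
  have hγ'' : 0 ≤ 2 * cS * γ₈ / max 1 (2 * B₀N * max 1 (qQ θ.D θ.L Cτ (betaTau τ) 1)) :=
    div_nonneg (mul_nonneg (mul_nonneg zero_le_two hcS) hγ₈pos.le) hB₀.le
  have hden : 0 < 2 * B₀N * (14 * ((θ.D - 1 : ℕ) : ℝ)) * M + 1 := by positivity
  have hcP3 : 0 < min (1 / 16) (min aI (min aT (min aS (1 / (2 * B₀N * (14 * ((θ.D - 1 : ℕ) : ℝ)) * M + 1))))) :=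
    lt_min (by norm_num) (lt_min haI (lt_min haT (lt_min haS (one_div_pos.2 hden))))
  -- THE GUARDED SOURCED b9 SOCKET OF PROPOSITION 3's FRAME FROM NODE N06's BINDERS (dag-n06-b FILE 5 §5), member laws BY NAME from the index
  have SB9srcH2Per := sockB9P3srcH2Per_opsAllZdPer_towerBondsP θ.L τ hD θ.two_le_L hτp hτt hτs hCτ ops₀ hM1
    (fun a : IdxB8SubDPerκ θ P Mκ Rκ => a.toZdIdx) (fun _ => P) (fun a => ⟨(a.pos).ne'⟩) (fun a => a.Ω_zero) (s := 1)
    (fun a => a.dvd) (fun a j hj κ => (transferHyps_idxB8SubDPer θ P).2.2.2 a.1 j hj κ)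
    (fun a => levelSepPP0_of_levelSepPP (IdxB8SubD.levelSepPP_towerBondsP a.1.1 _ le_rfl))
    (γ := γ₈) (β := β) (len := len) hinv hglob hhol hsrc hsrcH hB₀N hcS hcSβ
  -- PROPOSITION 3 AS PRINTED at the κ-periodic family FROM THE BOTH-POINTS SOCKET (dag-n05-w1's server), `inp := ⟨B₀, B₀′⟩`, `C₂ := 2097152(d+1)²L²`
  have hP3 := prop3_famB8OfRecordSubBP₂DPerκ_of_sockB9P3H2Per (θ := θ) (P := P) (M₁ := Mκ) (R := Rκ) hD
    ⟨max 1 (2 * B₀N * max 1 (qQ θ.D θ.L Cτ (betaTau τ) 1)), B₀', hB₀, hB₀'⟩ hB₀β.le le_rfl hcP3' β len SB9H2Per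
  -- (10)′ A VERBATIM
  exact exists_residB8_slot8κ'_of_guardedSockets_at θ hD Mκ Rκ P hB₀ hB₀' hB₀β hρ₀ hc₁s hP6 hcP hcu hcP3 hγ₈ hγ' hγ'' hB hB₀8 hγB hγB'' hB8β hB₁big
    SP5base SP5 SH59src SP5u SB9srcH2Per hP3 p5ePer p5uPer

end BindersPer

end Summit.QuantumFields.YangMills.BalabanUVNodes.N05SubBP2DK2PerKappaSlotExistsOfBindersPer

end
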